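import Mathlib
import HarnessLib
import Literature.NumberTheory.LFunctions.ZetaSubconvexity
import Literature.NumberTheory.LFunctions.CubicSumAiry
import Literature.NumberTheory.LFunctions.GaussSumQuadraticPhase
import Literature.NumberTheory.LFunctions.PartialSumsFourierCutoff
import Literature.NumberTheory.LFunctions.BourgainTheorem4SixthMoment

/-!
# The main term of a Huxley–Watt block as a `θ`-average of Bourgain's `h`-sums (PROVED)

Topic `Literature/NumberTheory/LFunctions`. This file finishes the second half of the reduction
(3.4) in §4 of J. Bourgain, *Decoupling, exponential sums and the Riemann zeta function*, J. AMS 30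
(2017) ("By following … the steps of §4 in [H-W] that precede Equation (4.8) there …"): after
`CubicSum.cubicSum_airy` a minor block (`μqN'² ≥ 1`) of Bourgain's zeta sum is, up to the recorded
error, `q⁻¹ ∑_{h∈W'} G(a, b+h; q) e(ω_h s) 𝔣 e(-2μy_h³) (12πμy_h)^{-1/2}`
(`y_h = ((h - qλ)/(3μq))^{1/2}`), and here this main term is brought to the shape
`∑_{h≤H} αʰ e(x₁h + x₂h² + x₃h^{3/2} + x₄h^{1/2})` of (3.4) (`bourgainHSum` of
`BourgainTheorem4SixthMoment.lean`), following S. W. Graham–G. Kolesnik, *Van der Corput's Method of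
Exponential Sums* (LMS LN 126, 1991), end of §7.7:

* `airyMain_eq`: `𝔣 e(-2μy³)(12πμy)^{-1/2} = 𝔣 · w(h̃) · e(-κ h̃^{3/2})`, `h̃ = h - qλ`,
  `κ = 2μ(3μq)^{-3/2}` (`kappa`), `w(h̃) = (12πμ (h̃/(3μq))^{1/2})^{-1/2}` (`ampl`, decreasing,
  `≤ (12πμN')^{-1/2}` on the window: `ampl_antitone`, `ampl_le`).
* `rho`, `abs_rho'_le`, `tv_e_rho_le`: `(h - τ)^{3/2} = h^{3/2} - (3/2)τh^{1/2} + ρ_τ(h)` with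
  `|ρ'_τ(h)| ≤ (3/16) h^{-3/2}` for `|τ| ≤ 1/2`, so `e(-κρ)` has total variation `≪ κ h₀^{-1/2}` and is
  removed together with the amplitude by Abel summation (`weight_abel_le`, `norm_sum_weight_mul_le`;
  GK: "we may use Lemma 7.2 to remove the factor (3μch)^{-1/4} from the inner sum").
* `GaussPhase.gauss_phase_parity` (Lemma 7.11): on each parity class of `h`,
  `G(a, b+h; q) = γ e(x₂h² + x₁h)`, `x₂ = -ā/(4q)`, `x₁ = -āb/(2q)`, `|γ| ≤ (2q)^{1/2}`; the parity
  condition is detected by `(1 + (-1)^{h-r})/2` (`sum_filter_parity_eq`), which is the origin of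
  `ε = ±1` in `α = ε e(-θ)`.
* `term_eq`: one term equals `(γ𝔣e(-λs)) · W(h) · e(x·(h, h², h^{3/2}, h^{1/2}))` with the vector
  `x = xvec q ā b μ s λ = ({x₁ + s/q}, {x₂}, -κ, (3/2)κqλ)` (integer multiples of `h`, `h²` are
  dropped from the phase, so the first two coordinates may be reduced to `[-1/2, 1/2]`).
* the sharp cutoffs `h ≤ h''` of the Abel summation are removed by the Fourier cutoff
  `PartialSums.norm_sum_Ioc_le_integral_cutoffKernel` (GK Lemma 7.3 in integral form), producing the
  average over `θ` with the kernel `K_H`, `∫₀¹ K_H ≤ 2 + log H`, and the twist `e(-hθ)` absorbed in `α`.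

Main result `norm_mainTerm_le`: for `μqN'² ≥ 1`, `|qλ| ≤ 1/2`, `N' = L + s ≥ 1`, `L ≤ n₁`,
`n₁ + s ≤ 2N'`, `qλ + 3μq(n₁+s)² ≤ H`,
`‖MT‖ ≤ 2(1 + 6/(μq²N'))(μqN')^{-1/2} (I₁ + I₋₁)`,
`I_ε = ∫₀¹ K_H(θ)‖bourgainHSum H (ε e(-θ)) x‖ dθ` (`thetaIntegral`). The factor `(μqN')^{-1/2}` is
Bourgain's `R Q^{-1/2}` up to the normalisation `μN'² ≍ R⁻²`.

Everything is PROVED; no named fact is introduced.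

## References

* J. Bourgain, *Decoupling, exponential sums and the Riemann zeta function*, J. Amer. Math. Soc. 30
  (2017), 205–224 — §4, (3.4). [BourgainJAMS2017]
* S. W. Graham, G. Kolesnik, *Van der Corput's Method of Exponential Sums*, LMS Lecture Note Series
  126, Cambridge Univ. Press 1991 — §7.7 (last two displays), Lemmas 7.2, 7.3, 7.11, 7.16.
  [GrahamKolesnik1991]
* M. N. Huxley, N. Watt, *Exponential sums and the Riemann zeta function*, Proc. London Math. Soc.
  (3) 57 (1988), 1–24 — §4. [HuxleyWatt1988]
-/

noncomputable section

open Real Complex Finset Set MeasureTheory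
open Literature.Analysis.Fourier (fresnelC norm_fresnelC_le)
open Literature.NumberTheory.EllipticCurves.ModularForms (quadGaussSum)
open Literature.NumberTheory.LFunctions.CubicSum (airyMain stationaryWindow mem_stationaryWindow_iff)
open Literature.NumberTheory.LFunctions.GaussPhase (gauss_phase_parity)
open Literature.NumberTheory.LFunctions.PartialSums (cutoffKernel norm_sum_Ioc_mul_le_abel
  sum_norm_sub_le_of_deriv norm_sum_Ioc_le_integral_cutoffKernel cutoffKernel_nonneg)

namespace Literature.NumberTheory.LFunctions
namespace HSum

/-! ### The Airy–Hardy main term factorised: amplitude times `e(-κ h̃^{3/2})` -/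

/-- The amplitude `w(h̃) = (12πμ y)^{-1/2}`, `y = (h̃/(3μq))^{1/2}`. [cite: GrahamKolesnik1991, Lemma 7.16] -/
def ampl (μ q h : ℝ) : ℝ := (Real.sqrt (12 * π * μ * Real.sqrt (h / (3 * μ * q))))⁻¹

/-- The coefficient `κ = 2μ/(3μq)^{3/2}` of `h̃^{3/2}` in the Airy phase `2μy³ = κ h̃^{3/2}`.
[cite: GrahamKolesnik1991, Lemma 7.16] -/
def kappa (μ q : ℝ) : ℝ := 2 * μ / ((3 * μ * q) * Real.sqrt (3 * μ * q))

/-- `x^{3/2}` as `x √x`. [folklore] -/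
def pow32 (x : ℝ) : ℝ := x * Real.sqrt x

/-- `κ > 0`. [folklore] -/
theorem kappa_pos {μ q : ℝ} (hμ : 0 < μ) (hq : 0 < q) : 0 < kappa μ q := by
  unfold kappa; positivity

/-- `w(h̃) > 0` for `h̃ > 0`. [folklore] -/
theorem ampl_pos {μ q h : ℝ} (hμ : 0 < μ) (hq : 0 < q) (hh : 0 < h) : 0 < ampl μ q h := by
  unfold ampl
  have : 0 < Real.sqrt (h / (3 * μ * q)) := Real.sqrt_pos.2 (by positivity)
  positivity

/-- `2μ y³ = κ h̃^{3/2}` (`y = (h̃/(3μq))^{1/2}`, `h̃ ≥ 0`). [folklore] -/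
theorem two_mul_sqrt_cube (μ q h : ℝ) (hμ : 0 < μ) (hq : 0 < q) (hh : 0 ≤ h) :
    2 * μ * Real.sqrt (h / (3 * μ * q)) ^ 3 = kappa μ q * pow32 h := by
  have h3 : 0 < 3 * μ * q := by positivity
  rw [pow_succ, pow_two, Real.mul_self_sqrt (by positivity), Real.sqrt_div hh,
    kappa, pow32]
  have hs : Real.sqrt (3 * μ * q) ≠ 0 := (Real.sqrt_pos.2 h3).ne'
  field_simp

/-- **Factorisation of the main term:** `airyMain μ q h̃ = 𝔣 · w(h̃) · e(-κ h̃^{3/2})` (`h̃ ≥ 0`).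
[cite: GrahamKolesnik1991, Lemma 7.16] -/
theorem airyMain_eq {μ q h : ℝ} (hμ : 0 < μ) (hq : 0 < q) (hh : 0 ≤ h) :
    airyMain μ q h = fresnelC * (ampl μ q h : ℂ) *
      Complex.exp (2 * π * I * (-(kappa μ q * pow32 h) : ℝ)) := by
  rw [airyMain, two_mul_sqrt_cube μ q h hμ hq hh, ampl]
  ring

/-- The amplitude is antitone in `h̃ ≥ 0`. [folklore] -/
theorem ampl_antitone {μ q h h' : ℝ} (hμ : 0 < μ) (hq : 0 < q) (hh : 0 < h) (hhh' : h ≤ h') :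
    ampl μ q h' ≤ ampl μ q h := by
  unfold ampl
  have h1 : 0 < Real.sqrt (h / (3 * μ * q)) := Real.sqrt_pos.2 (by positivity)
  have hpos : 0 < Real.sqrt (12 * π * μ * Real.sqrt (h / (3 * μ * q))) := Real.sqrt_pos.2 (by positivity)
  rw [inv_le_inv₀ (lt_of_lt_of_le hpos (Real.sqrt_le_sqrt (by gcongr))) hpos]
  gcongr

/-- **Size of the amplitude at the bottom of the window:** if `h̃ ≥ 3μqN'²` (`N' > 0`) then
`w(h̃) ≤ (12πμN')^{-1/2}`. [cite: GrahamKolesnik1991, Lemma 7.16] -/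
theorem ampl_le {μ q h N' : ℝ} (hμ : 0 < μ) (hq : 0 < q) (hN' : 0 < N') (hh : 3 * μ * q * N' ^ 2 ≤ h) :
    ampl μ q h ≤ 1 / Real.sqrt (12 * π * μ * N') := by
  have h0 : 0 < 3 * μ * q * N' ^ 2 := by positivity
  have h1 := ampl_antitone hμ hq h0 hh
  refine h1.trans (le_of_eq ?_)
  unfold ampl
  rw [one_div]
  congr 2
  rw [show 3 * μ * q * N' ^ 2 / (3 * μ * q) = N' ^ 2 by field_simp, Real.sqrt_sq hN'.le]

/-! ### The expansion `(h - τ)^{3/2} = h^{3/2} - (3/2)τ h^{1/2} + ρ(h)` and the variation of `e(-κρ)` -/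

/-- `ρ_τ(h) = (h-τ)^{3/2} - h^{3/2} + (3/2)τ h^{1/2}`. [folklore] -/
def rho (τ h : ℝ) : ℝ := pow32 (h - τ) - pow32 h + 3 / 2 * τ * Real.sqrt h

/-- `ρ'_τ(h) = (3/2)(h-τ)^{1/2} - (3/2)h^{1/2} + (3/4)τ h^{-1/2}`. [folklore] -/
def rho' (τ h : ℝ) : ℝ := 3 / 2 * Real.sqrt (h - τ) - 3 / 2 * Real.sqrt h + 3 / 4 * τ / Real.sqrt h

/-- `(x^{3/2})' = (3/2)√x` for `x > 0`. [folklore] -/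
theorem hasDerivAt_pow32 {x : ℝ} (hx : 0 < x) : HasDerivAt pow32 (3 / 2 * Real.sqrt x) x := by
  have h1 := Real.hasDerivAt_sqrt hx.ne'
  have h2 := (hasDerivAt_id x).mul h1
  refine h2.congr_deriv ?_
  simp only [id]
  have hs : Real.sqrt x ≠ 0 := (Real.sqrt_pos.2 hx).ne'
  field_simp
  rw [Real.sq_sqrt hx.le]
  ring

/-- `ρ_τ' = rho'` on `h > max(τ, 0)`. [folklore] -/
theorem hasDerivAt_rho {τ h : ℝ} (hτ : τ < h) (hh : 0 < h) : HasDerivAt (rho τ) (rho' τ h) h := by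
  unfold rho rho'
  have h1 : HasDerivAt (fun h => pow32 (h - τ)) (3 / 2 * Real.sqrt (h - τ) * 1) h :=
    (hasDerivAt_pow32 (by linarith)).comp h ((hasDerivAt_id h).sub_const τ)
  have h2 := hasDerivAt_pow32 hh
  have h3 : HasDerivAt (fun h => 3 / 2 * τ * Real.sqrt h) (3 / 2 * τ * (1 / (2 * Real.sqrt h))) h :=
    (Real.hasDerivAt_sqrt hh.ne').const_mul _
  exact ((h1.sub h2).add h3).congr_deriv (by field_simp; ring)

/-- `ρ'(h) = -(3/4)τ² / (√h (√(h-τ) + √h)²)`. [folklore] -/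
theorem rho'_eq {τ h : ℝ} (hτ : τ < h) (hh : 0 < h) :
    rho' τ h = -(3 / 4) * τ ^ 2 / (Real.sqrt h * (Real.sqrt (h - τ) + Real.sqrt h) ^ 2) := by
  unfold rho'
  have hs : 0 < Real.sqrt h := Real.sqrt_pos.2 hh
  have hs' : 0 < Real.sqrt (h - τ) := Real.sqrt_pos.2 (by linarith)
  have hsum : 0 < Real.sqrt (h - τ) + Real.sqrt h := by positivity
  have key : Real.sqrt (h - τ) - Real.sqrt h = -τ / (Real.sqrt (h - τ) + Real.sqrt h) := by
    rw [eq_div_iff hsum.ne']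
    have e1 : Real.sqrt (h - τ) * Real.sqrt (h - τ) = h - τ := Real.mul_self_sqrt (by linarith)
    have e2 : Real.sqrt h * Real.sqrt h = h := Real.mul_self_sqrt hh.le
    nlinarith [e1, e2]
  have : 3 / 2 * Real.sqrt (h - τ) - 3 / 2 * Real.sqrt h = 3 / 2 * (Real.sqrt (h - τ) - Real.sqrt h) := by ring
  rw [this, key]
  field_simp
  have e1 : Real.sqrt (h - τ) ^ 2 = h - τ := Real.sq_sqrt (by linarith)
  have e2 : Real.sqrt h ^ 2 = h := Real.sq_sqrt hh.le
  nlinarith [e1, e2]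

/-- **`|ρ'(h)| ≤ (3/4) τ² h^{-3/2} ≤ (3/16) h^{-3/2}`** for `|τ| ≤ 1/2`, `h ≥ 1`. [folklore] -/
theorem abs_rho'_le {τ h : ℝ} (hτ : |τ| ≤ 1 / 2) (hh : 1 ≤ h) :
    |rho' τ h| ≤ 3 / 16 / (h * Real.sqrt h) := by
  have hτ' := abs_le.1 hτ
  have hh0 : 0 < h := by linarith
  have hτh : τ < h := by linarith
  rw [rho'_eq hτh hh0]
  have hs : 0 < Real.sqrt h := Real.sqrt_pos.2 hh0
  have hs' : 0 ≤ Real.sqrt (h - τ) := Real.sqrt_nonneg _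
  have hden : 0 < Real.sqrt h * (Real.sqrt (h - τ) + Real.sqrt h) ^ 2 := by positivity
  rw [abs_div, abs_of_pos hden, abs_mul, abs_neg, abs_of_pos (by norm_num : (0:ℝ) < 3 / 4), abs_pow,
    div_le_div_iff₀ hden (by positivity)]
  -- `3/4 τ² (h √h) ≤ 3/16 √h (√(h-τ) + √h)²` since `τ² ≤ 1/4` and `(√(h-τ) + √h)² ≥ h`
  have hsq : h ≤ (Real.sqrt (h - τ) + Real.sqrt h) ^ 2 := by
    have e2 : Real.sqrt h ^ 2 = h := Real.sq_sqrt hh0.le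
    nlinarith [mul_nonneg hs' hs.le]
  have hτ2 : |τ| ^ 2 ≤ (1 / 2) ^ 2 := pow_le_pow_left₀ (abs_nonneg _) hτ 2
  calc 3 / 4 * |τ| ^ 2 * (h * Real.sqrt h) ≤ 3 / 4 * (1 / 2) ^ 2 * (h * Real.sqrt h) := by gcongr
    _ = 3 / 16 * (Real.sqrt h * h) := by ring
    _ ≤ 3 / 16 * (Real.sqrt h * (Real.sqrt (h - τ) + Real.sqrt h) ^ 2) := by gcongr

/-- **Total variation of `e(-κρ(h))` over an integer range:** for `|τ| ≤ 1/2`, `κ ≥ 0` and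
integers `1 ≤ h₀ ≤ h₁`,
`∑_{h₀<h<h₁} ‖e(-κρ(h+1)) - e(-κρ(h))‖ ≤ (h₁ - h₀) · 2πκ · (3/16) / (h₀ √h₀)`. [folklore] -/
theorem tv_e_rho_le {τ κ : ℝ} (hτ : |τ| ≤ 1 / 2) (hκ : 0 ≤ κ) {h₀ h₁ : ℕ} (hh₀ : 1 ≤ h₀) (hh : h₀ ≤ h₁) :
    ∑ h ∈ Finset.Ico (h₀ + 1) h₁,
      ‖Complex.exp (2 * π * I * (-(κ * rho τ (h + 1 : ℕ))) ) - Complex.exp (2 * π * I * (-(κ * rho τ h)))‖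
      ≤ ((h₁ : ℝ) - h₀) * (2 * π * κ * (3 / 16 / (h₀ * Real.sqrt h₀))) := by
  have hh₀R : (1 : ℝ) ≤ h₀ := by exact_mod_cast hh₀
  set f : ℝ → ℂ := fun y => Complex.exp (2 * π * I * (-(κ * rho τ y))) with hf
  set D : ℝ := 2 * π * κ * (3 / 16 / (h₀ * Real.sqrt h₀)) with hD
  have hD0 : 0 ≤ D := by positivity
  have hτ' := abs_le.1 hτ
  have hderiv : ∀ y ∈ Icc (h₀ : ℝ) h₁, HasDerivWithinAt f (f y * (2 * π * I * (-(κ * rho' τ y)))) (Icc (h₀ : ℝ) h₁) y := by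
    intro y hy
    have hy1 : 1 ≤ y := hh₀R.trans hy.1
    have hρ := hasDerivAt_rho (τ := τ) (by linarith) (by linarith)
    have hreal : HasDerivAt (fun y : ℝ => -(κ * rho τ y)) (-(κ * rho' τ y)) y := (hρ.const_mul κ).neg
    have : HasDerivAt (fun y => (2 * π * I * (-(κ * rho τ y)) : ℂ)) (2 * π * I * (-(κ * rho' τ y))) y := by
      have h1 := (hreal.ofReal_comp).const_mul (2 * π * I)
      simp only [Complex.ofReal_neg, Complex.ofReal_mul] at h1
      exact h1
    exact ((Complex.hasDerivAt_exp _).comp y this).hasDerivWithinAt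
  have hbound : ∀ y ∈ Icc (h₀ : ℝ) h₁, ‖f y * (2 * π * I * (-(κ * rho' τ y)))‖ ≤ D := by
    intro y hy
    have hy1 : 1 ≤ y := hh₀R.trans hy.1
    have hfy : ‖f y‖ = 1 := by
      simp only [hf]
      rw [show (2 * π * I * (-(κ * rho τ y)) : ℂ) = ((2 * π * (-(κ * rho τ y))) : ℝ) * I by push_cast; ring]
      exact Complex.norm_exp_ofReal_mul_I _
    rw [norm_mul, hfy, one_mul]
    rw [show (2 * π * I * (-(κ * rho' τ y)) : ℂ) = ((2 * π * (-(κ * rho' τ y))) : ℝ) * I by push_cast; ring,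
      norm_mul, Complex.norm_I, mul_one, Complex.norm_real, Real.norm_eq_abs, abs_mul,
      abs_of_pos (by positivity : (0:ℝ) < 2 * π), abs_neg, abs_mul, abs_of_nonneg hκ]
    have h1 := abs_rho'_le hτ hy1
    have h2 : 3 / 16 / (y * Real.sqrt y) ≤ 3 / 16 / (h₀ * Real.sqrt h₀) := by
      apply div_le_div_of_nonneg_left (by norm_num) (by positivity)
      exact mul_le_mul hy.1 (Real.sqrt_le_sqrt hy.1) (Real.sqrt_nonneg _) (by linarith)
    rw [hD]
    calc 2 * π * (κ * |rho' τ y|) = 2 * π * κ * |rho' τ y| := by ring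
      _ ≤ 2 * π * κ * (3 / 16 / (h₀ * Real.sqrt h₀)) := by gcongr; exact h1.trans h2
  have := sum_norm_sub_le_of_deriv (f := f) hh hD0 hderiv hbound
  simpa [hf] using this

/-! ### Parity classes and the Fourier cutoff for `ℕ`-indexed sums -/

/-- Detecting a parity class: `∑_{h∈S, h≡r(2)} c(h) = (1/2)(∑_S c(h) + (-1)^r ∑_S (-1)^h c(h))`.
[folklore] -/
theorem sum_filter_parity_eq (c : ℕ → ℂ) (S : Finset ℕ) (r : ℕ) :
    ∑ h ∈ S.filter (fun h => h % 2 = r % 2), c h =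
      (1 / 2) * (∑ h ∈ S, c h + (-1) ^ r * ∑ h ∈ S, (-1) ^ h * c h) := by
  rw [Finset.sum_filter, Finset.mul_sum, ← Finset.sum_add_distrib, Finset.mul_sum]
  refine Finset.sum_congr rfl fun h _ => ?_
  have key : (-1 : ℂ) ^ r * (-1) ^ h = if h % 2 = r % 2 then 1 else -1 := by
    rw [← pow_add, neg_one_pow_eq_ite]
    by_cases hp : h % 2 = r % 2
    · rw [if_pos hp, if_pos (show Even (r + h) by rw [Nat.even_iff]; omega)]
    · rw [if_neg hp, if_neg (show ¬ Even (r + h) by rw [Nat.even_iff]; omega)]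
  rw [← mul_assoc, key]
  split_ifs <;> ring

/-- Hence `‖∑_{h∈S, h≡r(2)} c(h)‖ ≤ (1/2)(‖∑_S c(h)‖ + ‖∑_S (-1)^h c(h)‖)`. [folklore] -/
theorem norm_sum_filter_parity_le (c : ℕ → ℂ) (S : Finset ℕ) (r : ℕ) :
    ‖∑ h ∈ S.filter (fun h => h % 2 = r % 2), c h‖ ≤
      (1 / 2) * (‖∑ h ∈ S, c h‖ + ‖∑ h ∈ S, (-1 : ℂ) ^ h * c h‖) := by
  rw [sum_filter_parity_eq, norm_mul]
  have h2 : ‖(1 / 2 : ℂ)‖ = 1 / 2 := by simp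
  rw [h2]
  gcongr
  refine (norm_add_le _ _).trans ?_
  rw [norm_mul, norm_pow, norm_neg, norm_one, one_pow, one_mul]

/-- **Fourier cutoff for `ℕ`-indexed sums** (from `PartialSums.norm_sum_Ioc_le_integral_cutoffKernel`):
for `u ≤ v ≤ H`, `v - u ≤ L`,
`‖∑_{u<h≤v} c(h)‖ ≤ ∫₀¹ K_L(θ) ‖∑_{0<h≤H} c(h) e(-hθ)‖ dθ`. [cite: GrahamKolesnik1991, Lemma 7.3] -/
theorem norm_sum_Ioc_nat_le_integral (c : ℕ → ℂ) {u v H : ℕ} (huv : u ≤ v) (hvH : v ≤ H) {L : ℝ}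
    (hL : ((v : ℝ) - u) ≤ L) :
    ‖∑ h ∈ Finset.Ioc u v, c h‖ ≤
      ∫ θ in (0 : ℝ)..1, cutoffKernel L θ *
        ‖∑ h ∈ Finset.Ioc 0 H, c h * Complex.exp (-(2 * π * I * h * θ))‖ := by
  set a : ℤ → ℂ := fun n => c n.toNat with ha
  have hmain := norm_sum_Ioc_le_integral_cutoffKernel a (M := 0) (u := (u : ℤ)) (v := (v : ℤ)) (M₁ := (H : ℤ))
    (by positivity) (by exact_mod_cast huv) (by exact_mod_cast hvH) (L := L) (by push_cast; exact hL)
  -- transfer the sums from `ℤ` to `ℕ`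
  have hsum1 : ∑ n ∈ Finset.Ioc (u : ℤ) v, a n = ∑ h ∈ Finset.Ioc u v, c h := by
    refine Finset.sum_nbij' (fun n : ℤ => n.toNat) (fun h : ℕ => (h : ℤ)) ?_ ?_ ?_ ?_ ?_
    · intro n hn; rw [Finset.mem_Ioc] at hn ⊢; omega
    · intro h hh; rw [Finset.mem_Ioc] at hh ⊢; omega
    · intro n hn; rw [Finset.mem_Ioc] at hn; omega
    · intro h _; simp
    · intro n _; simp [ha]
  have hsum2 : ∀ θ : ℝ, ∑ m ∈ Finset.Ioc (0 : ℤ) H, a m * Complex.exp (-(2 * π * I * m * θ)) =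
      ∑ h ∈ Finset.Ioc 0 H, c h * Complex.exp (-(2 * π * I * h * θ)) := by
    intro θ
    refine Finset.sum_nbij' (fun n : ℤ => n.toNat) (fun h : ℕ => (h : ℤ)) ?_ ?_ ?_ ?_ ?_
    · intro n hn; rw [Finset.mem_Ioc] at hn ⊢; omega
    · intro h hh; rw [Finset.mem_Ioc] at hh ⊢; omega
    · intro n hn; rw [Finset.mem_Ioc] at hn; omega
    · intro h _; simp
    · intro n hn
      rw [Finset.mem_Ioc] at hn
      have hn0 : ((n.toNat : ℕ) : ℤ) = n := Int.toNat_of_nonneg (by omega)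
      simp only [ha]
      congr 2
      have : ((n.toNat : ℕ) : ℂ) = (n : ℂ) := by exact_mod_cast hn0
      rw [this]
  rw [hsum1] at hmain
  simp_rw [hsum2] at hmain
  exact hmain

/-- The twisted full sum is Bourgain's `∑_{h≤H} αʰ e(x·(h, h², h^{3/2}, h^{1/2}))` with `α = ε e(-θ)`:
`∑_{0<h≤H} εʰ e(Φ(h)) e(-hθ) = bourgainHSum H (ε e(-θ)) x`, `Φ(h) = ∑_k x_k m_k(h)`.
[cite: BourgainJAMS2017, §4 eq. (3.4)] -/
theorem sum_twist_eq_bourgainHSum (H : ℕ) (ε : ℂ) (x : Fin 4 → ℝ) (θ : ℝ) :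
    ∑ h ∈ Finset.Ioc 0 H, (ε ^ h * VdC.e (∑ k, x k * bourgainMonomials h k)) * Complex.exp (-(2 * π * I * h * θ))
      = bourgainHSum H (ε * Complex.exp (-(2 * π * I * θ))) x := by
  rw [bourgainHSum, show Finset.Ioc 0 H = Finset.Icc 1 H from rfl]
  refine Finset.sum_congr rfl fun h _ => ?_
  rw [mul_pow, ← Complex.exp_nat_mul, show ((h : ℂ) * -(2 * π * I * θ)) = -(2 * π * I * h * θ) by ring]
  ring


/-! ### Removing the amplitude and the weight `e(-κρ)` by Abel summation -/

/-- The weight `W(h) = w(h - τ) e(-κ ρ_τ(h))`. [folklore] -/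
def weight (μ q τ κ : ℝ) (h : ℕ) : ℂ :=
  (ampl μ q (h - τ) : ℂ) * Complex.exp (2 * π * I * (-(κ * rho τ h)))

/-- `|e(-κρ(h))| = 1`. [folklore] -/
theorem norm_e_neg_rho (κ τ : ℝ) (h : ℕ) : ‖Complex.exp (2 * π * I * (-(κ * rho τ h)))‖ = 1 := by
  rw [show (2 * π * I * (-(κ * rho τ h)) : ℂ) = ((2 * π * (-(κ * rho τ h))) : ℝ) * I by push_cast; ring]
  exact Complex.norm_exp_ofReal_mul_I _

/-- `‖W(h)‖ = w(h - τ)` for `h > τ`. [folklore] -/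
theorem norm_weight {μ q τ κ : ℝ} (hμ : 0 < μ) (hq : 0 < q) {h : ℕ} (hh : τ < h) :
    ‖weight μ q τ κ h‖ = ampl μ q (h - τ) := by
  rw [weight, norm_mul, norm_e_neg_rho, mul_one, Complex.norm_real, Real.norm_eq_abs,
    abs_of_pos (ampl_pos hμ hq (by linarith))]

/-- **Total size of the weight for Abel summation:** for `|τ| ≤ 1/2`, `κ ≥ 0`, `1 ≤ n₀ ≤ v`,
`‖W(v)‖ + ∑_{n₀<h<v} ‖W(h+1) - W(h)‖ ≤ w(n₀ + 1 - τ) (1 + V)`, `V = (v-n₀)·2πκ(3/16)/(n₀√n₀)`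
(the amplitude is decreasing, so its variation telescopes; the variation of `e(-κρ)` is
`tv_e_rho_le`). This is the quantity multiplying the maximal partial sum in
`PartialSums.norm_sum_Ioc_mul_le_abel` for the sum over `n₀ < h ≤ v`. [folklore] -/
theorem weight_abel_le {μ q τ κ : ℝ} (hμ : 0 < μ) (hq : 0 < q) (hτ : |τ| ≤ 1 / 2) (hκ : 0 ≤ κ)
    {n₀ v : ℕ} (hn₀ : 1 ≤ n₀) (hv : n₀ + 1 ≤ v) :
    ‖weight μ q τ κ v‖ + ∑ h ∈ Finset.Ico (n₀ + 1) v, ‖weight μ q τ κ (h + 1) - weight μ q τ κ h‖ ≤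
      ampl μ q ((n₀ + 1 : ℕ) - τ) * (1 + ((v : ℝ) - n₀) * (2 * π * κ * (3 / 16 / (n₀ * Real.sqrt n₀)))) := by
  have hτ' := abs_le.1 hτ
  have hn₀R : (1 : ℝ) ≤ n₀ := by exact_mod_cast hn₀
  have hτu : ∀ {h : ℕ}, n₀ + 1 ≤ h → τ < h := fun {h} hh => by
    have : ((n₀ + 1 : ℕ) : ℝ) ≤ h := by exact_mod_cast hh
    push_cast at this; linarith
  have hpos : ∀ {h : ℕ}, n₀ + 1 ≤ h → 0 < (h : ℝ) - τ := fun hh => by linarith [hτu hh]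
  set A : ℕ → ℝ := fun h => ampl μ q (h - τ) with hA
  set E : ℕ → ℂ := fun h => Complex.exp (2 * π * I * (-(κ * rho τ h))) with hE
  have hW : ∀ h, weight μ q τ κ h = (A h : ℂ) * E h := fun h => rfl
  -- antitonicity of `A`
  have hAmono : ∀ {h h' : ℕ}, n₀ + 1 ≤ h → h ≤ h' → A h' ≤ A h := fun {h h'} hh hhh' => by
    simp only [hA]
    exact ampl_antitone hμ hq (hpos hh) (by gcongr)
  have hApos : ∀ {h : ℕ}, n₀ + 1 ≤ h → 0 < A h := fun hh => ampl_pos hμ hq (hpos hh)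
  -- the step bound
  have hstep : ∀ h ∈ Finset.Ico (n₀ + 1) v, ‖weight μ q τ κ (h + 1) - weight μ q τ κ h‖ ≤
      (A h - A (h + 1)) + A (n₀ + 1) * ‖E (h + 1) - E h‖ := by
    intro h hh
    rw [Finset.mem_Ico] at hh
    have e : weight μ q τ κ (h + 1) - weight μ q τ κ h =
        ((A (h + 1) - A h : ℝ) : ℂ) * E (h + 1) + (A h : ℂ) * (E (h + 1) - E h) := by
      rw [hW, hW]; push_cast; ring
    rw [e]
    refine (norm_add_le _ _).trans (add_le_add ?_ ?_)
    · rw [norm_mul, show E (h + 1) = Complex.exp (2 * π * I * (-(κ * rho τ (h + 1 : ℕ)))) from rfl,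
        norm_e_neg_rho, mul_one, Complex.norm_real, Real.norm_eq_abs, abs_sub_comm,
        abs_of_nonneg (sub_nonneg.2 (hAmono hh.1 (Nat.le_succ h)))]
    · rw [norm_mul, Complex.norm_real, Real.norm_eq_abs, abs_of_pos (hApos hh.1)]
      exact mul_le_mul_of_nonneg_right (hAmono le_rfl hh.1) (norm_nonneg _)
  -- telescoping
  have htel : ∑ h ∈ Finset.Ico (n₀ + 1) v, (A h - A (h + 1)) = A (n₀ + 1) - A v := by
    rw [Finset.sum_Ico_eq_sum_range]
    have := Finset.sum_range_sub' (fun k => A (n₀ + 1 + k)) (v - (n₀ + 1))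
    simp only [add_zero] at this
    rw [show n₀ + 1 + (v - (n₀ + 1)) = v by omega] at this
    rw [← this]
    refine Finset.sum_congr rfl fun k _ => ?_
    rw [show n₀ + 1 + (k + 1) = n₀ + 1 + k + 1 by ring]
  -- the variation of `E`
  have hvar : ∑ h ∈ Finset.Ico (n₀ + 1) v, ‖E (h + 1) - E h‖ ≤
      ((v : ℝ) - n₀) * (2 * π * κ * (3 / 16 / (n₀ * Real.sqrt n₀))) :=
    tv_e_rho_le hτ hκ hn₀ (by omega)
  rw [norm_weight hμ hq (hτu hv)]
  calc A v + ∑ h ∈ Finset.Ico (n₀ + 1) v, ‖weight μ q τ κ (h + 1) - weight μ q τ κ h‖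
      ≤ A v + ∑ h ∈ Finset.Ico (n₀ + 1) v, ((A h - A (h + 1)) + A (n₀ + 1) * ‖E (h + 1) - E h‖) :=
        by linarith [Finset.sum_le_sum hstep]
    _ = A v + (A (n₀ + 1) - A v) + A (n₀ + 1) * ∑ h ∈ Finset.Ico (n₀ + 1) v, ‖E (h + 1) - E h‖ := by
        rw [Finset.sum_add_distrib, htel, ← Finset.mul_sum]; ring
    _ ≤ A (n₀ + 1) + A (n₀ + 1) * (((v : ℝ) - n₀) * (2 * π * κ * (3 / 16 / (n₀ * Real.sqrt n₀)))) := by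
        have := mul_le_mul_of_nonneg_left hvar (hApos le_rfl).le
        linarith
    _ = A (n₀ + 1) * (1 + ((v : ℝ) - n₀) * (2 * π * κ * (3 / 16 / (n₀ * Real.sqrt n₀)))) := by ring

/-- **Abel summation with the Airy weight:** if all partial sums `‖∑_{n₀<h≤h''} c(h)‖` (`n₀ ≤ h'' ≤ v`)
are `≤ B`, then `‖∑_{n₀<h≤v} W(h) c(h)‖ ≤ w(n₀ + 1 - τ)(1 + V) B`.
[cite: GrahamKolesnik1991, Lemma 7.2 (applied as in §7.7, "we may use Lemma 7.2 to remove the factor (3μch)^{-1/4}")] -/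
theorem norm_sum_weight_mul_le {μ q τ κ : ℝ} (hμ : 0 < μ) (hq : 0 < q) (hτ : |τ| ≤ 1 / 2) (hκ : 0 ≤ κ)
    {n₀ v : ℕ} (hn₀ : 1 ≤ n₀) (hv : n₀ + 1 ≤ v) (c : ℕ → ℂ) {B : ℝ}
    (hB : ∀ h'' ∈ Finset.Icc n₀ v, ‖∑ h ∈ Finset.Ioc n₀ h'', c h‖ ≤ B) :
    ‖∑ h ∈ Finset.Ioc n₀ v, weight μ q τ κ h * c h‖ ≤
      ampl μ q ((n₀ + 1 : ℕ) - τ) * (1 + ((v : ℝ) - n₀) * (2 * π * κ * (3 / 16 / (n₀ * Real.sqrt n₀)))) * B := by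
  have hB0 : 0 ≤ B := (norm_nonneg _).trans (hB n₀ (Finset.mem_Icc.2 ⟨le_rfl, by omega⟩))
  have h1 := norm_sum_Ioc_mul_le_abel c (weight μ q τ κ) (by omega : n₀ ≤ v) hB
  exact h1.trans (mul_le_mul_of_nonneg_right (weight_abel_le hμ hq hτ hκ hn₀ hv) hB0)


/-! ### The vector `x(I)` and the core phase -/

/-- Fractional representative in `[-1/2, 1/2]`. [folklore] -/
def fr (y : ℝ) : ℝ := y - round y

/-- `|fr y| ≤ 1/2`. [folklore] -/
theorem abs_fr_le (y : ℝ) : |fr y| ≤ 1 / 2 := abs_sub_round y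

/-- The Huxley–Watt vector `x(I) ∈ ℝ⁴` of the block: coefficients of `(h, h², h^{3/2}, h^{1/2})`,
`x = ({-āb/(2q) + s/q}, {-ā/(4q)}, -κ, (3/2)κ qλ)` (`{·}` the representative in `[-1/2, 1/2]`).
[cite: BourgainJAMS2017, §4 eq. (3.4) ("we skip the definition of x(I)")] -/
def xvec (q : ℕ) (abar b : ℤ) (μ s lam : ℝ) : Fin 4 → ℝ :=
  ![fr (-(abar : ℝ) * b / (2 * q) + s / q), fr (-(abar : ℝ) / (4 * q)), -kappa μ q,
    3 / 2 * kappa μ q * (q * lam)]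

/-- The core phase `Φ(h) = ∑_k x_k m_k(h)` written out. [folklore] -/
theorem phase_eq (q : ℕ) (abar b : ℤ) (μ s lam : ℝ) (h : ℕ) :
    ∑ k, xvec q abar b μ s lam k * bourgainMonomials h k =
      fr (-(abar : ℝ) * b / (2 * q) + s / q) * h + fr (-(abar : ℝ) / (4 * q)) * (h : ℝ) ^ 2
        + (-kappa μ q) * pow32 h + 3 / 2 * kappa μ q * (q * lam) * Real.sqrt h := by
  rw [Fin.sum_univ_four]
  simp only [xvec, bourgainMonomials, Matrix.cons_val_zero, Matrix.cons_val_one, Matrix.head_cons,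
    Matrix.cons_val_two, Matrix.tail_cons, Matrix.cons_val_three]
  have h0 : (0 : ℝ) ≤ h := Nat.cast_nonneg _
  have h32 : (h : ℝ) ^ (3 / 2 : ℝ) = pow32 h := by
    rw [pow32, show (3 / 2 : ℝ) = 1 + 1 / 2 by norm_num, Real.rpow_add' h0 (by norm_num), Real.rpow_one,
      Real.sqrt_eq_rpow]
  have h12 : (h : ℝ) ^ (1 / 2 : ℝ) = Real.sqrt h := (Real.sqrt_eq_rpow _).symm
  rw [h32, h12]

/-- `VdC.e x = exp(2πix)`. [folklore] -/
theorem e_eq_exp (x : ℝ) : VdC.e x = Complex.exp (2 * π * I * x) := by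
  unfold VdC.e; congr 1; push_cast; ring

/-! ### The key per-term identity -/

/-- **One term of the main sum, factorised.** With `τ = qλ`, `κ = kappa μ q`, `h ≥ 1` an integer in the
parity class `r`, and `G(a, b+h; q) = γ e(x₂h² + x₁h)` (`x₂ = -ā/(4q)`, `x₁ = -āb/(2q)`):
`G(a,b+h;q) e(ω_h s) airyMain(h - τ) = (γ 𝔣 e(-λs)) · W(h) · e(Φ(h))`, `W(h) = w(h-τ)e(-κρ(h))`,
`Φ(h) = ∑_k x_k m_k(h)` — the integer `round(x₂)h² + round(x₁ + s/q)h` drops out of `e(·)`. [folklore] -/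
theorem term_eq {q : ℕ} (hq : 0 < q) {abar b : ℤ} {γ : ℂ} {μ s lam : ℝ} (hμ : 0 < μ)
    (hlam : |q * lam| ≤ 1 / 2) {h : ℕ} (hh : 1 ≤ h) (G : ℂ)
    (hGeq : G = γ * Complex.exp (2 * π * I * ((-(abar : ℝ) / (4 * q)) * (h : ℤ) ^ 2
      + (-(abar : ℝ) * b / (2 * q)) * (h : ℤ) : ℝ))) :
    G * (Complex.exp (2 * π * I * (((h : ℤ) - q * lam) / q * s : ℝ)) * airyMain μ q ((h : ℤ) - q * lam)) =
      (γ * fresnelC * Complex.exp (2 * π * I * (-(lam * s) : ℝ))) *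
        (weight μ q (q * lam) (kappa μ q) h * VdC.e (∑ k, xvec q abar b μ s lam k * bourgainMonomials h k)) := by
  have hqR : (0 : ℝ) < q := by exact_mod_cast hq
  have hτ' := abs_le.1 hlam
  have hhR : (1 : ℝ) ≤ h := by exact_mod_cast hh
  have hhtau : 0 ≤ (h : ℝ) - q * lam := by linarith
  rw [hGeq, show (((h : ℤ) : ℝ) - q * lam) = (h : ℝ) - q * lam by push_cast; ring,
    airyMain_eq hμ hqR hhtau, weight, phase_eq, e_eq_exp]
  -- collect all exponentials
  set x₂ : ℝ := -(abar : ℝ) / (4 * q) with hx₂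
  set x₁ : ℝ := -(abar : ℝ) * b / (2 * q) with hx₁
  set κ : ℝ := kappa μ q with hκ
  set τ : ℝ := q * lam with hτ
  set A : ℝ := x₂ * (h : ℝ) ^ 2 + x₁ * h + ((h : ℝ) - τ) / q * s + -(κ * pow32 ((h : ℝ) - τ)) with hA
  set B : ℝ := -(lam * s) + -(κ * rho τ h) + (fr (x₁ + s / q) * h + fr x₂ * (h : ℝ) ^ 2
    + -κ * pow32 h + 3 / 2 * κ * τ * Real.sqrt h) with hB
  -- the difference is an integer
  set n : ℤ := round x₂ * (h : ℤ) ^ 2 + round (x₁ + s / q) * h with hn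
  have hAB : A = B + n := by
    simp only [hA, hB, hn, fr, rho, hτ]
    push_cast
    field_simp
    ring
  have hL : γ * Complex.exp (2 * π * I * ((x₂ * ((h : ℤ) : ℝ) ^ 2 + x₁ * ((h : ℤ) : ℝ)) : ℝ)) *
      (Complex.exp (2 * π * I * (((h : ℝ) - q * lam) / q * s : ℝ)) *
        (fresnelC * (ampl μ q ((h : ℝ) - q * lam) : ℂ) * Complex.exp (2 * π * I * (-(kappa μ q * pow32 ((h : ℝ) - q * lam)) : ℝ))))
      = γ * fresnelC * (ampl μ q ((h : ℝ) - τ) : ℂ) * Complex.exp (2 * π * I * A) := by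
    have : Complex.exp (2 * π * I * A) = Complex.exp (2 * π * I * ((x₂ * ((h : ℤ) : ℝ) ^ 2 + x₁ * ((h : ℤ) : ℝ)) : ℝ))
        * Complex.exp (2 * π * I * (((h : ℝ) - q * lam) / q * s : ℝ))
        * Complex.exp (2 * π * I * (-(kappa μ q * pow32 ((h : ℝ) - q * lam)) : ℝ)) := by
      rw [← Complex.exp_add, ← Complex.exp_add]
      congr 1
      simp only [hA, hκ, hτ]
      push_cast
      ring
    rw [this]
    ring
  have hR : (γ * fresnelC * Complex.exp (2 * π * I * (-(lam * s) : ℝ))) *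
      (((ampl μ q ((h : ℝ) - τ) : ℂ) * Complex.exp (2 * π * I * (-(κ * rho τ h)))) *
        Complex.exp (2 * π * I * ((fr (x₁ + s / q) * h + fr x₂ * (h : ℝ) ^ 2 + -κ * pow32 h
          + 3 / 2 * κ * τ * Real.sqrt h : ℝ))))
      = γ * fresnelC * (ampl μ q ((h : ℝ) - τ) : ℂ) * Complex.exp (2 * π * I * B) := by
    have : Complex.exp (2 * π * I * B) = Complex.exp (2 * π * I * (-(lam * s) : ℝ))
        * Complex.exp (2 * π * I * (-(κ * rho τ h)))
        * Complex.exp (2 * π * I * ((fr (x₁ + s / q) * h + fr x₂ * (h : ℝ) ^ 2 + -κ * pow32 h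
          + 3 / 2 * κ * τ * Real.sqrt h : ℝ))) := by
      rw [← Complex.exp_add, ← Complex.exp_add]
      congr 1
      simp only [hB]
      push_cast
      ring
    rw [this]
    ring
  rw [hL, hR, hAB]
  congr 1
  push_cast
  rw [show (2 * π * I * ((B : ℂ) + (n : ℂ)) : ℂ) = 2 * π * I * B + n * (2 * π * I) by ring, Complex.exp_add,
    Complex.exp_int_mul_two_pi_mul_I, mul_one]


/-! ### The main term of a minor block as a `θ`-average of Bourgain's `h`-sums -/

/-- The `θ`-integral `I_ε = ∫₀¹ K_H(θ) ‖∑_{h≤H} (ε e(-θ))ʰ e(x·(h,h²,h^{3/2},h^{1/2}))‖ dθ`. [folklore] -/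
def thetaIntegral (H : ℕ) (ε : ℂ) (x : Fin 4 → ℝ) : ℝ :=
  ∫ θ in (0 : ℝ)..1, cutoffKernel H θ * ‖bourgainHSum H (ε * Complex.exp (-(2 * π * I * θ))) x‖

/-- `I_ε ≥ 0` (`H ≥ 1`). [folklore] -/
theorem thetaIntegral_nonneg (H : ℕ) (hH : 1 ≤ H) (ε : ℂ) (x : Fin 4 → ℝ) : 0 ≤ thetaIntegral H ε x := by
  unfold thetaIntegral
  refine intervalIntegral.integral_nonneg zero_le_one fun θ hθ => ?_
  exact mul_nonneg (PartialSums.cutoffKernel_nonneg (by exact_mod_cast (by omega : 0 ≤ H)) hθ.1 hθ.2) (norm_nonneg _)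

set_option maxHeartbeats 1000000 in
/-- **The main term of a minor Huxley–Watt block is a `θ`-average of Bourgain's `h`-sums (the shape
of (3.4)).** Let `q ≥ 1`, `a ā ≡ 1 (mod q)`, `μ > 0`, `|qλ| ≤ 1/2`, `N' = L + s ≥ 1`,
`n₁ + s ≤ 2N'`, `μqN'² ≥ 1` (minor arc) and `qλ + 3μq(n₁+s)² ≤ H`. Then the main term of
`CubicSum.cubicSum_airy`,
`MT = q⁻¹ ∑_{h ∈ W'} G(a, b+h; q) e(ω_h s) 𝔣 e(-2μy_h³)(12πμy_h)^{-1/2}`, satisfies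
`‖MT‖ ≤ 2 (1 + 6/(μq²N')) (μqN')^{-1/2} (I₁ + I₋₁)`,
`I_ε = ∫₀¹ K_H(θ) ‖∑_{h ≤ H} (ε e(-θ))ʰ e(x·(h, h², h^{3/2}, h^{1/2}))‖ dθ` (`thetaIntegral`,
`bourgainHSum` of `BourgainTheorem4SixthMoment.lean`, `K_H` the cutoff kernel of
`PartialSumsFourierCutoff.lean` with `∫K_H ≤ 2 + log H`), `x = xvec q ā b μ s λ`. Here
`(μqN')^{-1/2} ≍ R/Q^{1/2}` is Bourgain's factor `R/Q^{1/2}` in (3.4), the parity split of the Gauss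
sums is absorbed into `ε = ±1`, the sharp cutoffs into `e(-θ)` ("`α ∈ {e(-η)}`"), the amplitude
`(12πμy_h)^{-1/2}` and the remainder `e(-κρ(h))` of `(h - qλ)^{3/2} = h^{3/2} - (3/2)qλ h^{1/2} + ρ(h)`
are removed by Abel summation.
[cite: BourgainJAMS2017, §4 eq. (3.4)] [cite: GrahamKolesnik1991, §7.7 (display after "The resulting inequality is")] -/
theorem norm_mainTerm_le {q : ℕ} [NeZero q] {a b abar : ℤ} (hab : (a : ZMod q) * (abar : ZMod q) = 1)
    {μ s lam : ℝ} {L n₁ H : ℕ} (hμ : 0 < μ) (hlam : |q * lam| ≤ 1 / 2) (hN' : 1 ≤ (L : ℝ) + s)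
    (hn₁ : L ≤ n₁) (hN₁' : (n₁ : ℝ) + s ≤ 2 * (L + s)) (hH₀ : 1 ≤ μ * q * (L + s) ^ 2)
    (hHcap : q * lam + 3 * μ * q * (n₁ + s) ^ 2 ≤ H) :
    ‖(1 / (q : ℂ)) * ∑ h ∈ stationaryWindow q μ s lam L n₁,
        quadGaussSum q a ((b : ZMod q) + (h : ZMod q)) *
          (Complex.exp (2 * π * I * ((h - q * lam) / q * s : ℝ)) * airyMain μ q (h - q * lam))‖ ≤
      2 * (1 + 6 / (μ * q ^ 2 * (L + s))) / Real.sqrt (μ * q * (L + s)) *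
        (thetaIntegral H 1 (xvec q abar b μ s lam) + thetaIntegral H (-1) (xvec q abar b μ s lam)) := by
  classical
  have hq : 0 < q := Nat.pos_of_ne_zero (NeZero.ne q)
  have hqR : (0 : ℝ) < q := by exact_mod_cast hq
  have hτ' := abs_le.1 hlam
  set x := xvec q abar b μ s lam with hx
  set τ : ℝ := q * lam with hτdef
  set κ : ℝ := kappa μ q with hκdef
  have hκ0 : 0 ≤ κ := (kappa_pos hμ hqR).le
  set N' : ℝ := (L : ℝ) + s with hN'def
  have hN'0 : 0 < N' := by linarith
  set H₀ : ℝ := μ * q * N' ^ 2 with hH₀def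
  -- the window as an integer interval
  set uZ : ℤ := ⌈q * lam + 3 * μ * q * ((L : ℝ) + s) ^ 2⌉ with huZ
  set vZ : ℤ := ⌊q * lam + 3 * μ * q * ((n₁ : ℝ) + s) ^ 2⌋ with hvZ
  have hW : stationaryWindow q μ s lam L n₁ = Finset.Icc uZ vZ := rfl
  have huZ_ge : τ + 3 * H₀ ≤ uZ := by
    rw [huZ]
    refine le_trans (le_of_eq ?_) (Int.le_ceil _)
    simp only [hτdef, hH₀def, hN'def]; ring
  have huZ2 : (2 : ℤ) ≤ uZ := by
    have : (2 : ℝ) < uZ := by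
      have h3 : 3 ≤ 3 * H₀ := by rw [hH₀def]; nlinarith
      linarith
    exact_mod_cast this.le
  have hvZ_le : (vZ : ℝ) ≤ τ + 3 * μ * q * ((n₁ : ℝ) + s) ^ 2 := Int.floor_le _
  have hvZH : vZ ≤ (H : ℤ) := by
    have : (vZ : ℝ) ≤ H := hvZ_le.trans hHcap
    exact_mod_cast this
  have hpref0 : 0 ≤ 2 * (1 + 6 / (μ * q ^ 2 * (L + s))) / Real.sqrt (μ * q * (L + s)) := by
    have : 0 < μ * q ^ 2 * (L + s) := by rw [← hN'def]; positivity
    have : 0 < μ * q * (L + s) := by rw [← hN'def]; positivity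
    positivity
  -- empty window: nothing to prove (the right-hand side is `≥ 0` once `H ≥ 1`; if `H = 0` it is `0`)
  rcases lt_or_ge vZ uZ with hempty | huv
  · rw [hW, Finset.Icc_eq_empty (not_le.2 hempty), Finset.sum_empty, mul_zero, norm_zero]
    refine mul_nonneg hpref0 (add_nonneg ?_ ?_) <;>
    · unfold thetaIntegral
      refine intervalIntegral.integral_nonneg zero_le_one fun θ hθ => mul_nonneg ?_ (norm_nonneg _)
      exact PartialSums.cutoffKernel_nonneg (Nat.cast_nonneg _) hθ.1 hθ.2
  -- nonempty window: `2 ≤ uZ ≤ vZ ≤ H`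
  have hH1 : 1 ≤ H := by
    have : (2 : ℤ) ≤ H := huZ2.trans (huv.trans hvZH)
    omega
  have hI0 : ∀ ε : ℂ, 0 ≤ thetaIntegral H ε x := fun ε => thetaIntegral_nonneg H hH1 ε x
  -- pass to natural numbers
  set u : ℕ := uZ.toNat with hudef
  set v : ℕ := vZ.toNat with hvdef
  have huz : (u : ℤ) = uZ := Int.toNat_of_nonneg (by omega)
  have hvz : (v : ℤ) = vZ := Int.toNat_of_nonneg (by omega)
  have hu2 : 2 ≤ u := by omega
  have huv' : u ≤ v := by omega
  have hvH : v ≤ H := by omega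
  have huR : (u : ℝ) = uZ := by exact_mod_cast huz
  have hvR : (v : ℝ) = vZ := by exact_mod_cast hvz
  -- the summand as a function of `h : ℕ`
  set F : ℕ → ℂ := fun h => quadGaussSum q a ((b : ZMod q) + ((h : ℤ) : ZMod q)) *
    (Complex.exp (2 * π * I * ((((h : ℤ) : ℝ) - q * lam) / q * s : ℝ)) * airyMain μ q (((h : ℤ) : ℝ) - q * lam))
    with hFdef
  have hsumN : ∑ h ∈ stationaryWindow q μ s lam L n₁,
      quadGaussSum q a ((b : ZMod q) + (h : ZMod q)) *
        (Complex.exp (2 * π * I * ((h - q * lam) / q * s : ℝ)) * airyMain μ q (h - q * lam))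
      = ∑ h ∈ Finset.Icc u v, F h := by
    rw [hW]
    refine Finset.sum_nbij' (fun n : ℤ => n.toNat) (fun h : ℕ => (h : ℤ)) ?_ ?_ ?_ ?_ ?_
    · intro n hn; rw [Finset.mem_Icc] at hn ⊢
      exact ⟨by rw [hudef]; exact Int.toNat_le_toNat hn.1, by rw [hvdef]; exact Int.toNat_le_toNat hn.2⟩
    · intro h hh; rw [Finset.mem_Icc] at hh ⊢
      exact ⟨by rw [← huz]; exact_mod_cast hh.1, by rw [← hvz]; exact_mod_cast hh.2⟩
    · intro n hn; rw [Finset.mem_Icc] at hn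
      exact Int.toNat_of_nonneg (by omega)
    · intro h _; simp
    · intro n hn
      rw [Finset.mem_Icc] at hn
      have hn0 : ((n.toNat : ℕ) : ℤ) = n := Int.toNat_of_nonneg (by omega)
      simp only [hFdef, hn0]
  rw [hsumN]
  -- the phase function and the two parity pieces
  set Φ : ℕ → ℂ := fun h => VdC.e (∑ k, x k * bourgainMonomials h k) with hΦdef
  set W : ℕ → ℂ := fun h => weight μ q τ κ h with hWdef
  have hsplit : ∑ h ∈ Finset.Icc u v, F h =
      ∑ h ∈ (Finset.Icc u v).filter (fun h => h % 2 = 0 % 2), F h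
        + ∑ h ∈ (Finset.Icc u v).filter (fun h => h % 2 = 1 % 2), F h := by
    rw [← Finset.sum_filter_add_sum_filter_not (Finset.Icc u v) (fun h => h % 2 = 0 % 2)]
    congr 1
    exact Finset.sum_congr (Finset.filter_congr fun h _ => by omega) fun _ _ => rfl
  -- each parity piece: `C_r * ∑_{Ioc (u-1) v} W(h) c_r(h)`
  have hpiece : ∀ r : ℕ, ∃ C : ℂ, ‖C‖ ≤ Real.sqrt (2 * q) * 6 ∧
      ∑ h ∈ (Finset.Icc u v).filter (fun h => h % 2 = r % 2), F h =
        C * ∑ h ∈ Finset.Ioc (u - 1) v, W h * (if h % 2 = r % 2 then Φ h else 0) := by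
    intro r
    obtain ⟨γ, hγ, hG⟩ := gauss_phase_parity (c := q) hab b (r : ℤ)
    refine ⟨γ * fresnelC * Complex.exp (2 * π * I * (-(lam * s) : ℝ)), ?_, ?_⟩
    · rw [norm_mul, norm_mul, show (2 * π * I * (-(lam * s) : ℝ) : ℂ) = ((2 * π * (-(lam * s))) : ℝ) * I by push_cast; ring,
        Complex.norm_exp_ofReal_mul_I, mul_one]
      exact mul_le_mul hγ norm_fresnelC_le (norm_nonneg _) (Real.sqrt_nonneg _)
    · have hIcc : Finset.Icc u v = Finset.Ioc (u - 1) v := by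
        ext h; simp only [Finset.mem_Icc, Finset.mem_Ioc]; omega
      rw [hIcc, Finset.mul_sum, Finset.sum_filter]
      refine Finset.sum_congr rfl fun h hh => ?_
      rw [Finset.mem_Ioc] at hh
      by_cases hp : h % 2 = r % 2
      · rw [if_pos hp, if_pos hp]
        have hcast : ((h : ℤ) % 2) = ((r : ℤ) % 2) := by exact_mod_cast hp
        have hGh := hG (h : ℤ) hcast
        have := term_eq (abar := abar) (b := b) (γ := γ) (s := s) hq hμ hlam (by omega : 1 ≤ h)
          (quadGaussSum q a ((b : ZMod q) + ((h : ℤ) : ZMod q))) hGh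
        simp only [hFdef]
        rw [this]
      · rw [if_neg hp, if_neg hp]; simp
  -- the common bound for the partial sums of `c_r`
  have hB : ∀ r : ℕ, ∀ h'' ∈ Finset.Icc (u - 1) v,
      ‖∑ h ∈ Finset.Ioc (u - 1) h'', (if h % 2 = r % 2 then Φ h else 0)‖ ≤
        (1 / 2) * (thetaIntegral H 1 x + thetaIntegral H (-1) x) := by
    intro r h'' hh''
    rw [Finset.mem_Icc] at hh''
    rw [← Finset.sum_filter]
    refine (norm_sum_filter_parity_le Φ _ r).trans ?_
    gcongr
    · -- `ε = 1`
      have h1 := norm_sum_Ioc_nat_le_integral Φ (u := u - 1) (v := h'') (H := H) hh''.1 (by omega) (L := H)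
        (by have : (h'' : ℝ) ≤ H := by exact_mod_cast (show h'' ≤ H by omega)
            linarith [(Nat.cast_nonneg (u - 1) : (0:ℝ) ≤ ((u - 1 : ℕ) : ℝ))])
      refine h1.trans (le_of_eq ?_)
      unfold thetaIntegral
      refine intervalIntegral.integral_congr fun θ _ => ?_
      congr 2
      rw [← sum_twist_eq_bourgainHSum H 1 x θ]
      refine Finset.sum_congr rfl fun h _ => ?_
      simp [hΦdef]
    · -- `ε = -1`
      have h1 := norm_sum_Ioc_nat_le_integral (fun h => (-1 : ℂ) ^ h * Φ h) (u := u - 1) (v := h'') (H := H)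
        hh''.1 (by omega) (L := H)
        (by have : (h'' : ℝ) ≤ H := by exact_mod_cast (show h'' ≤ H by omega)
            linarith [(Nat.cast_nonneg (u - 1) : (0:ℝ) ≤ ((u - 1 : ℕ) : ℝ))])
      refine h1.trans (le_of_eq ?_)
      unfold thetaIntegral
      refine intervalIntegral.integral_congr fun θ _ => ?_
      congr 2
      rw [← sum_twist_eq_bourgainHSum H (-1) x θ]
  -- Abel per parity piece
  have hu1 : 1 ≤ u - 1 := by omega
  have huu : u - 1 + 1 = u := by omega
  have hamp : ampl μ q ((u - 1 + 1 : ℕ) - τ) ≤ 1 / Real.sqrt (12 * π * μ * N') := by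
    rw [huu]
    refine ampl_le hμ hqR hN'0 ?_
    have e : (3 * μ * q * N' ^ 2 : ℝ) = 3 * H₀ := by rw [hH₀def]; ring
    rw [e]
    linarith [huZ_ge, huR]
  set V : ℝ := ((v : ℝ) - (u - 1 : ℕ)) * (2 * π * κ * (3 / 16 / ((u - 1 : ℕ) * Real.sqrt (u - 1 : ℕ)))) with hVdef
  have hV : V ≤ 6 / (μ * q ^ 2 * N') := by
    -- `v - (u-1) ≤ 11 H₀`, `u - 1 ≥ H₀`, `κ/√H₀ ≤ 2/(5 μ q² N')`, `33π/8 ≤ 13`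
    have hu1R : ((u - 1 : ℕ) : ℝ) = u - 1 := by
      rw [Nat.cast_sub (by omega)]; simp
    have hH₀1 : 1 ≤ H₀ := by rw [hH₀def]; exact hH₀
    have hcount : (v : ℝ) - (u - 1 : ℕ) ≤ 11 * H₀ := by
      rw [hu1R, hvR]
      have hmono : 3 * μ * q * ((n₁ : ℝ) + s) ^ 2 ≤ 12 * H₀ := by
        rw [hH₀def]
        have : ((n₁ : ℝ) + s) ^ 2 ≤ 4 * N' ^ 2 := by
          have hlow : -(2 * N') ≤ (n₁ : ℝ) + s := by
            have : (L : ℝ) ≤ n₁ := by exact_mod_cast hn₁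
            rw [hN'def]; linarith
          nlinarith [hN₁', hlow]
        have hμq : 0 ≤ μ * q := by positivity
        nlinarith [mul_le_mul_of_nonneg_left this hμq]
      have h1 : (uZ : ℝ) ≥ τ + 3 * H₀ := huZ_ge
      linarith [hvZ_le]
    have hden : H₀ ≤ ((u - 1 : ℕ) : ℝ) := by
      rw [hu1R, huR]; linarith [huZ_ge, hτ'.1]
    have hκH : κ / Real.sqrt H₀ ≤ 2 / (5 * (μ * q ^ 2 * N')) := by
      rw [hκdef, kappa, hH₀def]
      have hsq : Real.sqrt (μ * q * N' ^ 2) = Real.sqrt (μ * q) * N' := by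
        rw [Real.sqrt_mul (by positivity), Real.sqrt_sq hN'0.le]
      have hsq3 : Real.sqrt (3 * μ * q) = Real.sqrt 3 * Real.sqrt (μ * q) := by
        rw [show 3 * μ * q = 3 * (μ * q) by ring, Real.sqrt_mul (by norm_num)]
      rw [hsq, hsq3]
      have hmq : 0 < Real.sqrt (μ * q) := Real.sqrt_pos.2 (by positivity)
      have h3 : (5 : ℝ) / 3 ≤ Real.sqrt 3 := by
        rw [Real.le_sqrt (by norm_num) (by norm_num)]; norm_num
      have hmq2 : Real.sqrt (μ * q) * Real.sqrt (μ * q) = μ * q := Real.mul_self_sqrt (by positivity)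
      rw [div_div, div_le_div_iff₀ (by positivity) (by positivity)]
      -- `2μ · 5(μ q² N') ≤ 2 · (3μq · √3 √(μq) · √(μq) N')` i.e. `5 μ² q² N' ≤ 3√3 μ² q² N'`
      have : 2 * μ * (5 * (μ * q ^ 2 * N')) ≤ 2 * (3 * μ * q * (5 / 3 * Real.sqrt (μ * q)) * (Real.sqrt (μ * q) * N')) := by
        have : 3 * μ * q * (5 / 3 * Real.sqrt (μ * q)) * (Real.sqrt (μ * q) * N') = 5 * μ * q * (μ * q) * N' := by
          calc 3 * μ * q * (5 / 3 * Real.sqrt (μ * q)) * (Real.sqrt (μ * q) * N')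
              = 5 * μ * q * (Real.sqrt (μ * q) * Real.sqrt (μ * q)) * N' := by ring
            _ = 5 * μ * q * (μ * q) * N' := by rw [hmq2]
        rw [this]; nlinarith [hμ, hqR, hN'0]
      refine this.trans ?_
      gcongr
    -- combine
    have hVle : V ≤ 11 * H₀ * (2 * π * κ * (3 / 16 / (H₀ * Real.sqrt H₀))) := by
      rw [hVdef]
      have h2u : (2 : ℝ) ≤ u := by exact_mod_cast hu2
      have hpos1 : 0 < ((u - 1 : ℕ) : ℝ) * Real.sqrt (u - 1 : ℕ) := by
        have : 0 < ((u - 1 : ℕ) : ℝ) := by rw [hu1R]; linarith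
        positivity
      have hfrac : 3 / 16 / (((u - 1 : ℕ) : ℝ) * Real.sqrt (u - 1 : ℕ)) ≤ 3 / 16 / (H₀ * Real.sqrt H₀) := by
        apply div_le_div_of_nonneg_left (by norm_num) (by positivity)
        exact mul_le_mul hden (Real.sqrt_le_sqrt hden) (Real.sqrt_nonneg _) (by linarith)
      have huvR : (u : ℝ) ≤ v := by exact_mod_cast huv'
      have hc0 : 0 ≤ (v : ℝ) - (u - 1 : ℕ) := by rw [hu1R]; linarith
      exact mul_le_mul hcount (mul_le_mul_of_nonneg_left hfrac (by positivity)) (by positivity) (by positivity)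
    have hid : 11 * H₀ * (2 * π * κ * (3 / 16 / (H₀ * Real.sqrt H₀))) = (33 * π / 8) * (κ / Real.sqrt H₀) := by
      have : H₀ ≠ 0 := by positivity
      field_simp
      ring
    have hVle2 : V ≤ (33 * π / 8) * (κ / Real.sqrt H₀) := hVle.trans (le_of_eq hid)
    have hpi : 33 * π / 8 ≤ 13 := by have := Real.pi_lt_d2; linarith
    have hκH0 : 0 ≤ κ / Real.sqrt H₀ := by positivity
    calc V ≤ (33 * π / 8) * (κ / Real.sqrt H₀) := hVle2
      _ ≤ 13 * (2 / (5 * (μ * q ^ 2 * N'))) := by gcongr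
      _ ≤ 6 / (μ * q ^ 2 * N') := by
          have hX : 0 < μ * q ^ 2 * N' := by positivity
          rw [show 13 * (2 / (5 * (μ * q ^ 2 * N'))) = (26 / 5) / (μ * q ^ 2 * N') by field_simp; ring]
          gcongr; norm_num
  -- bound each piece
  have hV0 : 0 ≤ V := by
    rw [hVdef]
    have hu1R : ((u - 1 : ℕ) : ℝ) = u - 1 := by rw [Nat.cast_sub (by omega)]; simp
    have huvR : (u : ℝ) ≤ v := by exact_mod_cast huv'
    have hc0 : 0 ≤ (v : ℝ) - (u - 1 : ℕ) := by rw [hu1R]; linarith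
    positivity
  have hpieceBound : ∀ r : ℕ, ‖∑ h ∈ (Finset.Icc u v).filter (fun h => h % 2 = r % 2), F h‖ ≤
      (Real.sqrt (2 * q) * 6) * ((1 / Real.sqrt (12 * π * μ * N')) * (1 + V) *
        ((1 / 2) * (thetaIntegral H 1 x + thetaIntegral H (-1) x))) := by
    intro r
    obtain ⟨C, hC, hCeq⟩ := hpiece r
    rw [hCeq, norm_mul]
    have hAbel := norm_sum_weight_mul_le (μ := μ) (q := (q : ℝ)) (τ := τ) (κ := κ) hμ hqR (by rw [hτdef]; exact hlam) hκ0
      hu1 (by omega : u - 1 + 1 ≤ v) (fun h => if h % 2 = r % 2 then Φ h else 0) (hB r)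
    refine mul_le_mul hC (hAbel.trans ?_) (norm_nonneg _) (by positivity)
    have hBB : 0 ≤ (1 / 2) * (thetaIntegral H 1 x + thetaIntegral H (-1) x) := by
      have := hI0 1; have := hI0 (-1); positivity
    exact mul_le_mul_of_nonneg_right (mul_le_mul_of_nonneg_right hamp (by linarith)) hBB
  -- combine the two parity pieces
  set P : ℝ := (Real.sqrt (2 * q) * 6) * ((1 / Real.sqrt (12 * π * μ * N')) * (1 + V) *
    ((1 / 2) * (thetaIntegral H 1 x + thetaIntegral H (-1) x))) with hPdef
  have htot : ‖∑ h ∈ Finset.Icc u v, F h‖ ≤ 2 * P := by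
    rw [hsplit]
    refine (norm_add_le _ _).trans ?_
    have h0 := hpieceBound 0
    have h1 := hpieceBound 1
    linarith
  rw [norm_mul, norm_div, norm_one, Complex.norm_natCast]
  -- the numerical prefactor
  set Isum : ℝ := thetaIntegral H 1 x + thetaIntegral H (-1) x with hIsum
  have hIsum0 : 0 ≤ Isum := add_nonneg (hI0 1) (hI0 (-1))
  have hsqμN : 0 < Real.sqrt (μ * N') := Real.sqrt_pos.2 (by positivity)
  have hsqq : 0 < Real.sqrt q := Real.sqrt_pos.2 hqR
  have e1 : Real.sqrt (2 * q) = Real.sqrt 2 * Real.sqrt q := Real.sqrt_mul (by norm_num) _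
  have e2 : Real.sqrt (12 * π * μ * N') = Real.sqrt (12 * π) * Real.sqrt (μ * N') := by
    rw [show 12 * π * μ * N' = (12 * π) * (μ * N') by ring, Real.sqrt_mul (by positivity)]
  have e3 : Real.sqrt (μ * q * N') = Real.sqrt q * Real.sqrt (μ * N') := by
    rw [show μ * q * N' = q * (μ * N') by ring, Real.sqrt_mul hqR.le]
  have hnum : 6 * Real.sqrt 2 ≤ 2 * Real.sqrt (12 * π) := by
    have hs2 : Real.sqrt 2 ≤ 3 / 2 := by rw [Real.sqrt_le_left (by norm_num)]; norm_num
    have hs12 : 6 ≤ Real.sqrt (12 * π) := by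
      rw [Real.le_sqrt (by norm_num) (by positivity)]; nlinarith [Real.pi_gt_three]
    linarith
  have hqq : Real.sqrt q * Real.sqrt q = q := Real.mul_self_sqrt hqR.le
  calc 1 / (q : ℝ) * ‖∑ h ∈ Finset.Icc u v, F h‖ ≤ 1 / (q : ℝ) * (2 * P) := by gcongr
    _ = (6 * Real.sqrt (2 * q) / ((q : ℝ) * Real.sqrt (12 * π * μ * N'))) * (1 + V) * Isum := by
        rw [hPdef]; ring
    _ ≤ (2 / Real.sqrt (μ * q * N')) * (1 + 6 / (μ * q ^ 2 * N')) * Isum := by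
        have hV' : 1 + V ≤ 1 + 6 / (μ * q ^ 2 * N') := by linarith
        have hfac : 6 * Real.sqrt (2 * q) / ((q : ℝ) * Real.sqrt (12 * π * μ * N')) ≤ 2 / Real.sqrt (μ * q * N') := by
          rw [e1, e2, e3, div_le_div_iff₀ (by positivity) (by positivity)]
          -- `6 √2 √q (√q √(μN')) ≤ 2 (q √(12π) √(μN'))`
          have : 6 * (Real.sqrt 2 * Real.sqrt q) * (Real.sqrt q * Real.sqrt (μ * N'))
              = (6 * Real.sqrt 2) * (q * Real.sqrt (μ * N')) := by
            calc 6 * (Real.sqrt 2 * Real.sqrt q) * (Real.sqrt q * Real.sqrt (μ * N'))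
                = 6 * Real.sqrt 2 * (Real.sqrt q * Real.sqrt q) * Real.sqrt (μ * N') := by ring
              _ = (6 * Real.sqrt 2) * (q * Real.sqrt (μ * N')) := by rw [hqq]; ring
          rw [this, show 2 * ((q : ℝ) * (Real.sqrt (12 * π) * Real.sqrt (μ * N'))) =
            (2 * Real.sqrt (12 * π)) * (q * Real.sqrt (μ * N')) by ring]
          exact mul_le_mul_of_nonneg_right hnum (by positivity)
        have hfac0 : 0 ≤ 6 * Real.sqrt (2 * q) / ((q : ℝ) * Real.sqrt (12 * π * μ * N')) := by positivity
        have h1V : 0 ≤ 1 + V := by linarith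
        apply mul_le_mul_of_nonneg_right _ hIsum0
        exact mul_le_mul hfac hV' h1V (by positivity)
    _ = 2 * (1 + 6 / (μ * q ^ 2 * N')) / Real.sqrt (μ * q * N') * Isum := by ring
end HSum
end Literature.NumberTheory.LFunctions
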